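import Literature.Probability.Percolation.ZdFourArmFromFiveArm
import Literature.Probability.Percolation.ZdPivotalFourArm
import Literature.Probability.Percolation.RSW
import HarnessLib

/-!
# Monotonicity of the five-arm event in the radii (bond percolation on `ℤ²`)

Topic `Literature/Probability/Percolation`; proofs only (no definition, no named fact). Companion
of `ZdFourArmFromFiveArm.lean` (the five-arm event `zdFiveArmClusters m n` in cluster form) in the
bottom-up layers towards `Kesten1987_zdKestenRelation` (`ZdNearCriticalWindow.lean`): as for the
four-arm and two-arm events (`FourArmGarbanMonotone.lean`), shrinking the annulus `A_{m,n}` from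
either side preserves the five-arm event (van den Berg–Nolin 2020, §2: "`π_k(n₁,n₂)` is
non-increasing in `n₂` and non-decreasing in `n₁`"; used tacitly in every five-arm argument,
e.g. Nolin 2008, proof of Thm. 24 (ii): arms to `∂S_N` give arms to `∂S_{N/2}(v)`). Since the
five-arm event records open WALKS and their edge-disjointness, the first-exit / last-entry
surgery is redone at the level of walks:

* `ZdFiveArm.exists_walk_of_le_right`, `ZdFiveArm.exists_walk_of_le_left` — truncating an open
  walk across `A_{m,n}` to `A_{m,n'}` (first exit) or `A_{m',n}` (last entry) yields a walk whose
  support and edges are among those of the original one;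
* `mem_zdFiveArmClusters_mono`, `real_zdFiveArmClusters_mono` — **`𝒜₅(A_{m,n}) ⊆ 𝒜₅(A_{m',n'})`
  on lattice configurations and `P_p(𝒜₅(A_{m,n})) ≤ P_p(𝒜₅(A_{m',n'}))` for
  `m ≤ m' ≤ n' ≤ n`** (edge-disjointness passes to sub-walks; a junction of the first two
  truncated walks in the smaller annulus, together with the discarded pieces, would join the
  original inner endpoints).
-/

noncomputable section

open MeasureTheory Set
open scoped unitInterval

namespace Literature.Probability.Percolation

open LatticeModels

/-! ### Walk-level surgery -/

/-- **Shrinking the outer radius, walk form.** A lattice walk inside `A_{m,n}` from a site `x` with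
`‖x‖_∞ = m` to a site with `‖·‖_∞ = n` has an initial piece inside `A_{m,n'}` ending on
`‖·‖_∞ = n'` (`m ≤ n' ≤ n`), whose support and edges are among those of the walk. [folklore] -/
theorem ZdFiveArm.exists_walk_of_le_right {m n' n : ℕ} (hmn' : m ≤ n') (hn'n : n' ≤ n)
    {x y : Site 2} (hx : x ∈ siteSphere m) (hy : y ∈ siteSphere n) (p : (zdGraph 2).Walk x y)
    (hps : ∀ z ∈ p.support, z ∈ sqAnnulus m n) :
    ∃ (y' : Site 2) (p' : (zdGraph 2).Walk x y'), y' ∈ siteSphere n' ∧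
      (∀ z ∈ p'.support, z ∈ sqAnnulus m n') ∧ (∀ z ∈ p'.support, z ∈ p.support) ∧
      ∀ e ∈ p'.edges, e ∈ p.edges := by
  classical
  have hm : 1 ≤ m := one_le_of_mem_siteSphere hx
  by_cases hxb : x ∈ box 2 (n' - 1)
  · have hyA : y ∉ ({v | v ∈ box 2 (n' - 1)} : Set (Site 2)) := by
      simp only [siteSphere, Finset.mem_sdiff] at hy
      exact fun h' => hy.2 (box_mono 2 (by omega) h')
    obtain ⟨x', z, q₁, hxz, hz, hA, hS, hE, hlast⟩ :=
      exists_prefix_exit (A := {v | v ∈ box 2 (n' - 1)}) p hxb hyA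
    have hzb : z ∈ box 2 n' := by
      have hx'b : x' - 0 ∈ box 2 (n' - 1) := by simpa using hA x' q₁.end_mem_support
      have := ZdPivotal.sub_mem_box_succ_of_adj hx'b hxz
      rw [Nat.sub_add_cancel (hm.trans hmn')] at this
      simpa using this
    have hzs : z ∈ siteSphere n' := Finset.mem_sdiff.2 ⟨hzb, hz⟩
    have hzp : z ∈ p.support := p.snd_mem_support_of_mem_edges hlast
    refine ⟨z, q₁.concat hxz, hzs, fun v hv => ?_, fun v hv => ?_, fun e he => ?_⟩
    · rw [SimpleGraph.Walk.support_concat, List.mem_append, List.mem_singleton] at hv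
      rcases hv with hv | rfl
      · have h1 := hps v (hS v hv)
        simp only [sqAnnulus, Finset.mem_coe, mem_annulus] at h1 ⊢
        exact ⟨box_mono 2 (Nat.sub_le n' 1) (hA v hv), h1.2⟩
      · have h1 := hps _ hzp
        simp only [sqAnnulus, Finset.mem_coe, mem_annulus] at h1 ⊢
        exact ⟨hzb, h1.2⟩
    · rw [SimpleGraph.Walk.support_concat, List.mem_append, List.mem_singleton] at hv
      rcases hv with hv | rfl
      · exact hS v hv
      · exact hzp
    · rw [SimpleGraph.Walk.edges_concat, List.concat_eq_append, List.mem_append,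
        List.mem_singleton] at he
      rcases he with he | rfl
      · exact hE e he
      · exact hlast
  · have hxs : x ∈ siteSphere n' := by
      simp only [siteSphere, Finset.mem_sdiff] at hx ⊢
      exact ⟨box_mono 2 hmn' hx.1, hxb⟩
    refine ⟨x, SimpleGraph.Walk.nil, hxs, ?_, ?_, ?_⟩
    · intro z hz
      rw [SimpleGraph.Walk.support_nil, List.mem_singleton] at hz
      subst hz
      exact mem_sqAnnulus_of_mem_siteSphere hmn' hx
    · intro z hz
      rw [SimpleGraph.Walk.support_nil, List.mem_singleton] at hz
      subst hz
      exact p.start_mem_support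
    · intro e he
      simp at he

/-- **Raising the inner radius, walk form.** A lattice walk inside `A_{m,n}` from `‖x‖_∞ = m` to
`‖y‖_∞ = n` has a final piece inside `A_{m',n}` starting on `‖·‖_∞ = m'` (`m ≤ m' ≤ n`), whose
support and edges are among those of the walk; its starting point lies on the walk. [folklore] -/
theorem ZdFiveArm.exists_walk_of_le_left {m m' n : ℕ} (hmm' : m ≤ m') (hm'n : m' ≤ n)
    {x y : Site 2} (hx : x ∈ siteSphere m) (hy : y ∈ siteSphere n) (p : (zdGraph 2).Walk x y)
    (hps : ∀ z ∈ p.support, z ∈ sqAnnulus m n) :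
    ∃ (x' : Site 2) (p' : (zdGraph 2).Walk x' y), x' ∈ siteSphere m' ∧ x' ∈ p.support ∧
      (∀ z ∈ p'.support, z ∈ sqAnnulus m' n) ∧ (∀ z ∈ p'.support, z ∈ p.support) ∧
      ∀ e ∈ p'.edges, e ∈ p.edges := by
  classical
  have hm : 1 ≤ m := one_le_of_mem_siteSphere hx
  rcases Nat.eq_or_lt_of_le hmm' with rfl | hlt
  · exact ⟨x, p, hx, p.start_mem_support, hps, fun z hz => hz, fun e he => he⟩
  have hyA : y ∈ ({v | v ∉ box 2 (m' - 1)} : Set (Site 2)) := by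
    simp only [siteSphere, Finset.mem_sdiff] at hy
    exact fun h' => hy.2 (box_mono 2 (by omega) h')
  have hxA : x ∉ ({v | v ∉ box 2 (m' - 1)} : Set (Site 2)) := by
    simp only [siteSphere, Finset.mem_sdiff] at hx
    exact fun h' => h' (box_mono 2 (by omega) hx.1)
  obtain ⟨x', z', q₃, hx'z', hz', hA', hS', hE', -⟩ :=
    exists_prefix_exit (A := {v | v ∉ box 2 (m' - 1)}) p.reverse hyA hxA
  have hz'box : z' ∈ box 2 (m' - 1) := not_not.1 hz'
  have hx'a : x' ∈ box 2 m' := by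
    have hz'b : z' - 0 ∈ box 2 (m' - 1) := by simpa using hz'box
    have := ZdPivotal.sub_mem_box_succ_of_adj hz'b hx'z'.symm
    rw [Nat.sub_add_cancel (hm.trans hmm')] at this
    simpa using this
  have hx's : x' ∈ siteSphere m' := Finset.mem_sdiff.2 ⟨hx'a, hA' x' q₃.end_mem_support⟩
  have hx'p : x' ∈ p.support := by
    have := hS' x' q₃.end_mem_support
    rwa [SimpleGraph.Walk.support_reverse, List.mem_reverse] at this
  refine ⟨x', q₃.reverse, hx's, hx'p, fun v hv => ?_, fun v hv => ?_, fun e he => ?_⟩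
  · rw [SimpleGraph.Walk.support_reverse, List.mem_reverse] at hv
    have h1 : v ∈ p.support := by
      have := hS' v hv
      rwa [SimpleGraph.Walk.support_reverse, List.mem_reverse] at this
    have h2 := hps v h1
    simp only [sqAnnulus, Finset.mem_coe, mem_annulus] at h2 ⊢
    exact ⟨h2.1, hA' v hv⟩
  · rw [SimpleGraph.Walk.support_reverse, List.mem_reverse] at hv
    have := hS' v hv
    rwa [SimpleGraph.Walk.support_reverse, List.mem_reverse] at this
  · rw [SimpleGraph.Walk.edges_reverse, List.mem_reverse] at he
    have := hE' e he
    rwa [SimpleGraph.Walk.edges_reverse, List.mem_reverse] at this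

/-! ### Monotonicity of the five-arm event -/

/-- **The five-arm event is monotone under shrinking the annulus** (lattice configurations): for
`m ≤ m' ≤ n' ≤ n`, `zdFiveArmClusters m n ⊆ zdFiveArmClusters m' n'` — truncate the three open
walks (last entry into `‖·‖_∞ ≤ m' - 1`, then first exit from `‖·‖_∞ ≤ n' - 1`); sub-walks of
edge-disjoint walks are edge-disjoint; a junction of the first two truncated walks inside
`A_{m',n'} ⊆ A_{m,n}`, together with the discarded initial pieces, would join the original inner
endpoints in `A_{m,n}`. (van den Berg–Nolin 2020, §2, monotonicity of arm events in the radii,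
for the cluster form of `π₅`.) [cite: VandenbergNolin2020, §2 (monotonicity of arm events in the radii)] -/
theorem mem_zdFiveArmClusters_mono {m m' n' n : ℕ} (hmm' : m ≤ m') (hm'n' : m' ≤ n') (hn'n : n' ≤ n)
    {ω : BondConfig (Site 2)} (h : ω ∈ zdFiveArmClusters m n) :
    ω ∈ zdFiveArmClusters m' n' := by
  classical
  obtain ⟨x₁, x₂, x₃, y₁, y₂, y₃, W₁, W₂, W₃, hx₁, hx₂, hx₃, hy₁, hy₂, hy₃, hs₁, hs₂, hs₃, he₁, he₂,
    he₃, hd₁, hd₂, hsep⟩ := h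
  -- raise the inner radius
  obtain ⟨a₁, P₁, ha₁, ha₁W, hP₁s, hP₁S, hP₁E⟩ :=
    ZdFiveArm.exists_walk_of_le_left hmm' (hm'n'.trans hn'n) hx₁ hy₁ W₁ hs₁
  obtain ⟨a₂, P₂, ha₂, ha₂W, hP₂s, hP₂S, hP₂E⟩ :=
    ZdFiveArm.exists_walk_of_le_left hmm' (hm'n'.trans hn'n) hx₂ hy₂ W₂ hs₂
  obtain ⟨a₃, P₃, ha₃, -, hP₃s, hP₃S, hP₃E⟩ :=
    ZdFiveArm.exists_walk_of_le_left hmm' (hm'n'.trans hn'n) hx₃ hy₃ W₃ hs₃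
  -- shrink the outer radius
  obtain ⟨b₁, Q₁, hb₁, hQ₁s, hQ₁S, hQ₁E⟩ := ZdFiveArm.exists_walk_of_le_right hm'n' hn'n ha₁ hy₁ P₁ hP₁s
  obtain ⟨b₂, Q₂, hb₂, hQ₂s, hQ₂S, hQ₂E⟩ := ZdFiveArm.exists_walk_of_le_right hm'n' hn'n ha₂ hy₂ P₂ hP₂s
  obtain ⟨b₃, Q₃, hb₃, hQ₃s, hQ₃S, hQ₃E⟩ := ZdFiveArm.exists_walk_of_le_right hm'n' hn'n ha₃ hy₃ P₃ hP₃s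
  refine ⟨a₁, a₂, a₃, b₁, b₂, b₃, Q₁, Q₂, Q₃, ha₁, ha₂, ha₃, hb₁, hb₂, hb₃, hQ₁s, hQ₂s, hQ₃s,
    fun e he => he₁ e (hP₁E e (hQ₁E e he)), fun e he => he₂ e (hP₂E e (hQ₂E e he)),
    fun e he => he₃ e (hP₃E e (hQ₃E e he)),
    fun e he h3 => hd₁ e (hP₁E e (hQ₁E e he)) (hP₃E e (hQ₃E e h3)),
    fun e he h3 => hd₂ e (hP₂E e (hQ₂E e he)) (hP₃E e (hQ₃E e h3)), fun hc => hsep ?_⟩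
  -- a junction in the smaller annulus joins `x₁` to `x₂` in the bigger one
  have hc' : ω ∈ openConnIn (sqAnnulus m n) a₁ a₂ :=
    openConnIn_mono (sqAnnulus_mono hmm' hn'n) a₁ a₂ hc
  have j₁ : ω ∈ openConnIn (sqAnnulus m n) x₁ a₁ := mem_openConnIn_of_mem_support W₁ hs₁ he₁ ha₁W
  have j₂ : ω ∈ openConnIn (sqAnnulus m n) x₂ a₂ := mem_openConnIn_of_mem_support W₂ hs₂ he₂ ha₂W
  rw [openConnIn_comm] at j₂
  exact PlanarDuality.openConnIn_trans (PlanarDuality.openConnIn_trans j₁ hc') j₂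

/-- **`π₅(m,n) ≤ π₅(m',n')` for `m ≤ m' ≤ n' ≤ n`** (every `p`; cluster-form five-arm event).
[cite: VandenbergNolin2020, §2 (monotonicity of arm events in the radii)] -/
theorem real_zdFiveArmClusters_mono (p : unitInterval) {m m' n' n : ℕ} (hmm' : m ≤ m') (hm'n' : m' ≤ n')
    (hn'n : n' ≤ n) :
    (bondPercolation (zdGraph 2) p).real (zdFiveArmClusters m n) ≤
      (bondPercolation (zdGraph 2) p).real (zdFiveArmClusters m' n') :=
  measureReal_mono fun _ hω => mem_zdFiveArmClusters_mono hmm' hm'n' hn'n hω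

end Literature.Probability.Percolation
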